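import Mathlib.MeasureTheory.Integral.Lebesgue.Markov
import Mathlib.MeasureTheory.Measure.Restrict
import HarnessLib

/-!
# S2β · LINE g18-1 · DET-REP-B‴∘ ∕ JACW — (J-PIN) brick 1: BLIND DENSITIES WITH EQUAL INTEGRALS ON BLIND SETS ARE A.E. EQUAL

Cell `ym3-torus` (rung R3: continuum `SU(2)` Yang–Mills on `T³` — NOT `d = 4`, NOT infinite volume, NOT a mass gap, NOT Clay); width seat `ym-ust-20520-w5` g16;
helper of the crux `stmt-QuantumFields-20520` (`--supports … --as helper`, NOT a proof of it).

WHY (FINDING #41 §3, road (R1)).  The JACW-ROW of `def DetRepB`‴∘ quantifies over EVERY window chart `c` with `ChartRows ∧ ChartRowsJ`; the product formula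
`Jac = 1_{windows}·Π_c jd c z (V c)` is known for the explicit chart of ✓`…S2BetaChartJacProduct.exists_fibredChart_iter_cont_blind_prod` (✓p761834).  PINNING an
arbitrary `c.jac` to that `Jac` goes through the two push-forward laws: both `jac·1_{histGood}(Φ)` and `Ĵ·1_{histGood}(Φ̂)` are densities, against `μ_J⌊O ⊗ ν_K`, of
the SAME measure tested on every set that is BLIND to the pivot coordinates (the charts move only the pivots: off-pivot identity + fibre identity turn
`1_E(Φ(V,z))` into `1_W(V,z)` for pivot-blind `W`), and both densities are themselves pivot-blind (`ChartRowsJ`; conjunct (19) of ✓IV-c).  THIS FILE is the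
measure-theoretic uniqueness step, GENERIC: on a finite measure space with a family of «resampling» maps `r i : X → X`, two measurable `ℝ≥0∞` densities that are
INVARIANT under every `r i`, one of them of finite integral, and whose integrals agree on every measurable INVARIANT set, agree almost everywhere — no sub-σ-algebra,
no conditional expectation: the bad sets `{f < g}`, `{g < f}` are themselves invariant, and Mathlib's Markov-type lemma `ae_eq_of_ae_le_of_lintegral_le` closes each.
* §1 ★★`ae_eq_of_setLIntegral_eq_of_invariant` (the generic statement) and `measure_setOf_lt_eq_zero_of_invariant` (one half).
* §2 ★`ae_eq_of_setLIntegral_eq_of_extendBlind` — the docking shape for fibred charts: `X = A × (Bd → G)`, resampling `(a, z) ↦ (a, extend β h z)` of the coordinates in the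
  range of an index map `β` (the pivots `iterCentralBond n` in the tower), any measure.
HONEST SCOPE.  Elementary measure theory (Mathlib); def-free; default heartbeats; proves nothing of (J-PIN)'s tower instance, BRD, DET-REP-B‴∘, S2β or the crux
20520; `YM3TorusSU2` NOT proved; the Yang–Mills mass gap (Clay) NOT proved.
References: [Bogachev2007] V. I. Bogachev, Measure Theory I (2007), Thm 2.5.3 / §10.1 (a.e. uniqueness of densities); [Balaban1987RG1] CMP 109 (1987) (2.10) p. 267
(the change of variables whose Jacobian is being pinned).
-/

set_option autoImplicit false

noncomputable section

open MeasureTheory Set Function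
open scoped ENNReal

namespace Summit.QuantumFields.YangMills.Theorems.FluctuationComparisonRegPrIntLS2BetaBlindDensityUniqueness

/-! ## §1 Invariant densities with equal integrals on invariant sets -/

section Generic

variable {X ι : Type*} [MeasurableSpace X] {μ : Measure X}

/-- **One half**: if `f, g` are measurable and invariant under every `r i`, `∫ f < ∞`, and `∫_W f = ∫_W g` on every measurable invariant `W`, then
`μ {f < g} = 0` — the set `{f < g}` is itself measurable and invariant, on it `f ≤ g` with equal integrals, so `f = g` a.e. there
(Mathlib `ae_eq_of_ae_le_of_lintegral_le`), contradicting `f < g` pointwise. [cite: Bogachev2007, Thm 2.5.3] -/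
theorem measure_setOf_lt_eq_zero_of_invariant (r : ι → X → X) {f g : X → ℝ≥0∞} (hf : Measurable f) (hg : Measurable g)
    (hfr : ∀ i x, f (r i x) = f x) (hgr : ∀ i x, g (r i x) = g x) (hfin : ∫⁻ x, f x ∂μ ≠ ∞)
    (h : ∀ W : Set X, MeasurableSet W → (∀ i x, r i x ∈ W ↔ x ∈ W) → ∫⁻ x in W, f x ∂μ = ∫⁻ x in W, g x ∂μ) :
    μ {x | f x < g x} = 0 := by
  set W : Set X := {x | f x < g x} with hW
  have hWm : MeasurableSet W := measurableSet_lt hf hg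
  have hWr : ∀ i x, r i x ∈ W ↔ x ∈ W := fun i x => by
    show f (r i x) < g (r i x) ↔ f x < g x
    rw [hfr, hgr]
  have hle : ∀ᵐ x ∂μ.restrict W, f x ≤ g x :=
    (ae_restrict_iff' hWm).2 (Filter.Eventually.of_forall fun x hx => le_of_lt hx)
  have hfinW : ∫⁻ x in W, f x ∂μ ≠ ∞ := ne_top_of_le_ne_top hfin (setLIntegral_le_lintegral W f)
  have hae : f =ᵐ[μ.restrict W] g := ae_eq_of_ae_le_of_lintegral_le hle hfinW hg.aemeasurable (h W hWm hWr).symm.le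
  have hno : ∀ᵐ x ∂μ.restrict W, x ∉ W := by
    filter_upwards [hae, (ae_restrict_iff' hWm).2 (Filter.Eventually.of_forall fun x (hx : x ∈ W) => hx)] with x hx hlt
    intro _
    exact absurd hx (ne_of_lt hlt)
  have h0 : μ.restrict W W = 0 := by
    have h1 := hno
    rw [ae_iff] at h1
    simp only [not_not, setOf_mem_eq] at h1
    exact h1
  rwa [Measure.restrict_apply_self] at h0

/-- ★★ **INVARIANT DENSITIES WITH EQUAL INTEGRALS ON INVARIANT SETS ARE A.E. EQUAL.**  Let `r i : X → X` (`i : ι`) be any family of maps («resampling the blind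
coordinates»), `f, g : X → ℝ≥0∞` measurable and invariant (`f ∘ r i = f`, `g ∘ r i = g`), `∫ f dμ < ∞`, and `∫_W f dμ = ∫_W g dμ` for every measurable `W` with
`r i ⁻¹ W = W` for all `i`.  Then `f = g` `μ`-a.e.  (No sub-σ-algebra is formed: both bad sets are invariant.) [cite: Bogachev2007, Thm 2.5.3] -/
theorem ae_eq_of_setLIntegral_eq_of_invariant (r : ι → X → X) {f g : X → ℝ≥0∞} (hf : Measurable f) (hg : Measurable g)
    (hfr : ∀ i x, f (r i x) = f x) (hgr : ∀ i x, g (r i x) = g x) (hfin : ∫⁻ x, f x ∂μ ≠ ∞)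
    (h : ∀ W : Set X, MeasurableSet W → (∀ i x, r i x ∈ W ↔ x ∈ W) → ∫⁻ x in W, f x ∂μ = ∫⁻ x in W, g x ∂μ) :
    f =ᵐ[μ] g := by
  have hgfin : ∫⁻ x, g x ∂μ ≠ ∞ := by
    have hu := h univ MeasurableSet.univ fun _ _ => by simp only [mem_univ]
    rw [Measure.restrict_univ] at hu
    rwa [← hu]
  have h1 : μ {x | f x < g x} = 0 := measure_setOf_lt_eq_zero_of_invariant r hf hg hfr hgr hfin h
  have h2 : μ {x | g x < f x} = 0 :=
    measure_setOf_lt_eq_zero_of_invariant r hg hf hgr hfr hgfin fun W hWm hWr => (h W hWm hWr).symm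
  have h12 : μ ({x | f x < g x} ∪ {x | g x < f x}) = 0 := measure_union_null h1 h2
  rw [Filter.EventuallyEq, ae_iff]
  refine measure_mono_null (fun x hx => ?_) h12
  rcases lt_or_gt_of_ne hx with hlt | hgt
  · exact Or.inl hlt
  · exact Or.inr hgt

end Generic

/-! ## §2 The docking shape for fibred charts: resampling the coordinates in the range of an index map -/

section Extend

variable {A Bd G κ : Type*} [MeasurableSpace A] [MeasurableSpace (Bd → G)]

/-- ★ **PIVOT-BLIND DENSITIES ON `A × (Bd → G)`**: with the resampling maps `(a, z) ↦ (a, extend β h z)` (`h : κ → G`; `β : κ → Bd` the pivot map — in the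
tower `β = iterCentralBond n`), two measurable `ℝ≥0∞` densities blind to the pivots, one of finite integral, with equal integrals on every measurable pivot-blind
set, are a.e. equal for ANY measure on the product (in the tower: `μ_J⌊O ⊗ ν_K`). [cite: Bogachev2007, Thm 2.5.3] [cite: Balaban1987RG1, (2.10) p.267] -/
theorem ae_eq_of_setLIntegral_eq_of_extendBlind (β : κ → Bd) {μ : Measure (A × (Bd → G))} {f g : A × (Bd → G) → ℝ≥0∞}
    (hf : Measurable f) (hg : Measurable g)
    (hfr : ∀ (h : κ → G) (p : A × (Bd → G)), f (p.1, extend β h p.2) = f p) (hgr : ∀ (h : κ → G) (p : A × (Bd → G)), g (p.1, extend β h p.2) = g p)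
    (hfin : ∫⁻ p, f p ∂μ ≠ ∞)
    (hW : ∀ W : Set (A × (Bd → G)), MeasurableSet W → (∀ (h : κ → G) (p : A × (Bd → G)), (p.1, extend β h p.2) ∈ W ↔ p ∈ W) →
      ∫⁻ p in W, f p ∂μ = ∫⁻ p in W, g p ∂μ) :
    f =ᵐ[μ] g :=
  ae_eq_of_setLIntegral_eq_of_invariant (fun (h : κ → G) (p : A × (Bd → G)) => ((p.1, extend β h p.2) : A × (Bd → G))) hf hg hfr hgr hfin hW

end Extend

end Summit.QuantumFields.YangMills.Theorems.FluctuationComparisonRegPrIntLS2BetaBlindDensityUniqueness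

end
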